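import Literature.IUT.LogVolume.Corollary22CMLogQ
import HarnessLib

/-!
# Route `IUTThetaPilot`, crux `ThetaPartII` (stmt-ABC-19678): the registered stub `stub_cmLow`

The birth skeleton of the crux `Summit.ABC.ABC.Theses.IUTThetaPilot.ThetaPartII` ([IUTchIV] Cor. 2.2 (ii),
uniform; registered `Lines/birth2.lean`, planner abc-iut-plan 2026-08-25T22:45:40Z) reduces it to two stubs:
`stub_cmLow` — the points of the `λ`-line with `j ∈ {0, 1728}` (the curves "that admit automorphisms of
order `> 2`", which Cor. 2.2 (ii), kurims p. 42, puts inside the exceptional set `Exc_d`) have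
`log(q^∀) = 0`, so that they lie in every low range `{log(q^∀) ≤ B}` — and `stub_theta` (the crux heart).
This file CLOSES `stub_cmLow` with the registered signature, by the tree theorem
`Literature.IUT.LogVolume.Cor22.logQForall_eq_zero_of_jInv_cm` (`Corollary22CMLogQ.lean`: integral `j` ⟹
no place of potentially multiplicative reduction ⟹ zero `q`-parameter divisor; junk conventions checked:
`jInv = 0` at the cusps and `1728 ∈ 𝓞_F` both give an empty support). Classical; nothing here bears on
`stub_theta` or takes a side on [IUTchIII] Cor. 3.12.
-/

namespace Summit.ABC.ABC.Theses.IUTThetaPilot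

open Literature.NumberTheory.DiophantineGeometry.GenEll Literature.IUT.LogVolume
open Literature.IUT.LogVolume.Cor22

set_option linter.dupNamespace false in
/-- **Stub `stub_cmLow` of the birth skeleton of `ThetaPartII`** (registered signature, verbatim): every
presented point of the `λ`-line with `j(λ) ∈ {0, 1728}` has `log(q^∀) = 0` ([IUTchIV] Cor. 2.2 (ii),
p. 42: the CM points belong to `Exc_d`; here: they belong to every low range). Proof: the tree theorem
`Cor22.logQForall_eq_zero_of_jInv_cm`. [claim: Mochizuki2012, status: disputed] -/
theorem stub_cmLow : ∀ P : NFPoint, (jInv P.x = 0 ∨ jInv P.x = 1728) → logQForall P = 0 :=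
  fun P h => logQForall_eq_zero_of_jInv_cm P h

end Summit.ABC.ABC.Theses.IUTThetaPilot
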